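import Summits.QuantumFields.QCD.Theorems.WindowExtinction.Negative.SpectralFlow
import Summits.QuantumFields.QCD.Theorems.ExtinctionBuildsQCD.Negative.IndexBudget

/-!
# `WindowExtinction` (crux stmt-QuantumFields-8964) — negative-side support:
# the coercivity band budget (index change of `H_W` across `[m₁, m₂]` ≤ small eigenvalues of `H_W(m₀)`)

Standing crux disprover, cycle 2 (2026-08-16). Part 1 of 2 of the tightness lemma "`c ≤ 1`" for the crux's clause (b)
(part 2: `WindowConstantLeOne.lean`). PARALLEL DERIVATION NOTICE: the sibling disprover of the bridge
`ExtinctionBuildsQCD` (stmt-QuantumFields-8968) obtained the two-matrix form of this budget independently and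
simultaneously (`|n₋(H_W(a)) − n₋(H_W(b))| ≤ #{|λ(H_W(a))| ≤ |b−a|}`, landing as
`Theorems/ExtinctionBuildsQCD/Negative/CoercivityCeiling.lean`); either may be cited.

* `abs_card_neg_sub_card_neg_le` / `abs_negCount_sub_le_countP_abs_le` (abstract, every Hermitian pencil
  `H(m) = ΓD + mΓ`, `Γ` Hermitian unitary, `ΓD` Hermitian): for `m₁ ≤ m₀ ≤ m₂`,
  `|n₋(H(m₁)) − n₋(H(m₂))| ≤ #{eigenvalues e of H(m₀) with |e| ≤ max(m₀ − m₁, m₂ − m₀)}` — the change of the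
  negative-eigenvalue count across `[m₁, m₂]` is CARRIED BY SMALL EIGENVALUES OF `H` AT ANY INTERMEDIATE MASS (four
  applications of the landed counting form of Weyl's inequality `card_filter_lt_neg_le` plus trichotomy; no
  eigenvalue continuity, no simplicity assumption).
* `abs_index_le_signDefects_add_coercivityBand` (every `SU(3)` gauge field): for a line `m_crit`, a flavour window
  `w_f > 0` (bare mass `m_crit + w_f`) and a probe depth `w_M ≥ 0`,
  `|n₋(Γ₅D_W(U, m_crit − w_M, 1)) − 6L⁴| ≤ #{real λ ∈ spec D_W(U,0,1), λ < −(m_crit + w_f)}`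
  ` + #{e ∈ spec Γ₅D_W(U, m_crit + w_f, 1), |e| ≤ w_f + w_M}` (triangle through `m₂ = m_crit + 2w_f + w_M`, landed
  `abs_index_le_realModeCount`); hence `abs_index_le_signDefects_add_coercivityDefects`: whenever `c w_f > w_f + w_M`
  — `c > 1 + M/m_f` in the crux's parameters — the TIGHT integrand is bounded by the clause-(a) + clause-(b) counts of
  ONE flavour, pathwise.
-/

namespace Summit.QuantumFields.QCD.Theorems.WindowExtinction.Negative

open Matrix MeasureTheory Filter
open Literature.MathematicalPhysics.QuantumLattice Literature.MathematicalPhysics.QuantumFieldTheory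
  Literature.Probability.LatticeModels
open Summit.QuantumFields.QCD.Theses.SpectralDefectExtinction
open Summit.QuantumFields.QCD.Theorems.ExtinctionBuildsQCD.Negative

noncomputable section

/-! ## §1 Abstract: the index change across `[m₁, m₂]` is carried by small eigenvalues of `H(m₀)` -/

section Abstract

variable {n : Type*} [Fintype n] [DecidableEq n]

/-- **Three Hermitian matrices: the negative-count change from `A₁` to `A₂` is carried by small
eigenvalues of `A₀`.** If `|Re v†(A₁ − A₀)v| ≤ δ₁‖v‖²` and `|Re v†(A₂ − A₀)v| ≤ δ₂‖v‖²` (`δ₁, δ₂ ≥ 0`), then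
`|#{λ(A₁) < 0} − #{λ(A₂) < 0}| ≤ #{|λ(A₀)| ≤ max δ₁ δ₂}`. Proof: counting-Weyl (`card_filter_lt_neg_le`)
gives `#{λ(A₂) < 0} ≥ #{λ(A₀) < −δ₂}` and `#{λ(A₁) > 0} ≥ #{λ(A₀) > δ₁}`, so
`#{λ(A₁) < 0} − #{λ(A₂) < 0} ≤ n − #{λ(A₀) > δ₁} − #{λ(A₀) < −δ₂} ≤ #{−δ₂ ≤ λ(A₀) ≤ δ₁}`; symmetrically. [folklore] -/
theorem abs_card_neg_sub_card_neg_le {A₀ A₁ A₂ : Matrix n n ℂ} (h₀ : A₀.IsHermitian) (h₁ : A₁.IsHermitian)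
    (h₂ : A₂.IsHermitian) {δ₁ δ₂ : ℝ} (hδ₁ : 0 ≤ δ₁) (hδ₂ : 0 ≤ δ₂)
    (hE₁ : ∀ v : n → ℂ, |(star v ⬝ᵥ (A₁ - A₀) *ᵥ v).re| ≤ δ₁ * ∑ i, ‖v i‖ ^ 2)
    (hE₂ : ∀ v : n → ℂ, |(star v ⬝ᵥ (A₂ - A₀) *ᵥ v).re| ≤ δ₂ * ∑ i, ‖v i‖ ^ 2) :
    |((Finset.univ.filter fun i => h₁.eigenvalues i < 0).card : ℤ) -
        ((Finset.univ.filter fun i => h₂.eigenvalues i < 0).card : ℤ)| ≤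
      ((Finset.univ.filter fun i => |h₀.eigenvalues i| ≤ max δ₁ δ₂).card : ℤ) := by
  -- the four counting steps, all with `A := A₀`
  have s1 := card_filter_lt_neg_le h₀ h₁ (σ := 1) (δ := δ₁) (Or.inl rfl) hE₁
  have s2 := card_filter_lt_neg_le h₀ h₁ (σ := -1) (δ := δ₁) (Or.inr rfl) hE₁
  have s3 := card_filter_lt_neg_le h₀ h₂ (σ := 1) (δ := δ₂) (Or.inl rfl) hE₂
  have s4 := card_filter_lt_neg_le h₀ h₂ (σ := -1) (δ := δ₂) (Or.inr rfl) hE₂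
  have e1 : (Finset.univ.filter fun i => (1 : ℝ) * h₀.eigenvalues i < -δ₁) =
      Finset.univ.filter fun i => h₀.eigenvalues i < -δ₁ :=
    Finset.filter_congr fun i _ => by rw [one_mul]
  have e2 : (Finset.univ.filter fun i => (-1 : ℝ) * h₀.eigenvalues i < -δ₁) =
      Finset.univ.filter fun i => δ₁ < h₀.eigenvalues i :=
    Finset.filter_congr fun i _ => by rw [neg_one_mul, neg_lt_neg_iff]
  have e3 : (Finset.univ.filter fun i => (1 : ℝ) * h₀.eigenvalues i < -δ₂) =
      Finset.univ.filter fun i => h₀.eigenvalues i < -δ₂ :=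
    Finset.filter_congr fun i _ => by rw [one_mul]
  have e4 : (Finset.univ.filter fun i => (-1 : ℝ) * h₀.eigenvalues i < -δ₂) =
      Finset.univ.filter fun i => δ₂ < h₀.eigenvalues i :=
    Finset.filter_congr fun i _ => by rw [neg_one_mul, neg_lt_neg_iff]
  have f1 : (Finset.univ.filter fun i => (1 : ℝ) * h₁.eigenvalues i < 0) =
      Finset.univ.filter fun i => h₁.eigenvalues i < 0 :=
    Finset.filter_congr fun i _ => by rw [one_mul]
  have f2 : (Finset.univ.filter fun i => (-1 : ℝ) * h₁.eigenvalues i < 0) =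
      Finset.univ.filter fun i => 0 < h₁.eigenvalues i :=
    Finset.filter_congr fun i _ => by rw [neg_one_mul, neg_lt_zero]
  have f3 : (Finset.univ.filter fun i => (1 : ℝ) * h₂.eigenvalues i < 0) =
      Finset.univ.filter fun i => h₂.eigenvalues i < 0 :=
    Finset.filter_congr fun i _ => by rw [one_mul]
  have f4 : (Finset.univ.filter fun i => (-1 : ℝ) * h₂.eigenvalues i < 0) =
      Finset.univ.filter fun i => 0 < h₂.eigenvalues i :=
    Finset.filter_congr fun i _ => by rw [neg_one_mul, neg_lt_zero]
  rw [e1, f1] at s1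
  rw [e2, f2] at s2
  rw [e3, f3] at s3
  rw [e4, f4] at s4
  -- trichotomies (negative and positive eigenvalues are disjoint subsets of `univ`)
  have t₁ : (Finset.univ.filter fun i => h₁.eigenvalues i < 0).card +
      (Finset.univ.filter fun i => 0 < h₁.eigenvalues i).card ≤ Fintype.card n := by
    rw [← Finset.card_union_of_disjoint (Finset.disjoint_filter.2 fun i _ h h' => by linarith),
      ← Finset.card_univ]
    exact Finset.card_le_card (Finset.subset_univ _)
  have t₂ : (Finset.univ.filter fun i => h₂.eigenvalues i < 0).card +
      (Finset.univ.filter fun i => 0 < h₂.eigenvalues i).card ≤ Fintype.card n := by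
    rw [← Finset.card_union_of_disjoint (Finset.disjoint_filter.2 fun i _ h h' => by linarith),
      ← Finset.card_univ]
    exact Finset.card_le_card (Finset.subset_univ _)
  -- the band count dominates the complements of the two pairs of far sets
  have cover : ∀ {a b : ℝ}, 0 ≤ a → 0 ≤ b → a ≤ max δ₁ δ₂ → b ≤ max δ₁ δ₂ →
      Fintype.card n ≤ (Finset.univ.filter fun i => a < h₀.eigenvalues i).card +
        (Finset.univ.filter fun i => h₀.eigenvalues i < -b).card +
          (Finset.univ.filter fun i => |h₀.eigenvalues i| ≤ max δ₁ δ₂).card := by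
    intro a b ha hb haℓ hbℓ
    rw [← Finset.card_univ]
    have hcov : (Finset.univ : Finset n) ⊆
        (Finset.univ.filter fun i => a < h₀.eigenvalues i) ∪
          (Finset.univ.filter fun i => h₀.eigenvalues i < -b) ∪
            (Finset.univ.filter fun i => |h₀.eigenvalues i| ≤ max δ₁ δ₂) := by
      intro i _
      simp only [Finset.mem_union, Finset.mem_filter, Finset.mem_univ, true_and]
      by_cases hgt : a < h₀.eigenvalues i
      · exact Or.inl (Or.inl hgt)
      · by_cases hlt : h₀.eigenvalues i < -b
        · exact Or.inl (Or.inr hlt)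
        · exact Or.inr (abs_le.2 ⟨by linarith [not_lt.1 hlt], by linarith [not_lt.1 hgt]⟩)
    calc (Finset.univ : Finset n).card ≤ _ := Finset.card_le_card hcov
      _ ≤ _ := Finset.card_union_le _ _
      _ ≤ _ := add_le_add (Finset.card_union_le _ _) le_rfl
  have band := cover hδ₁ hδ₂ (le_max_left _ _) (le_max_right _ _)
  have band' := cover hδ₂ hδ₁ (le_max_right _ _) (le_max_left _ _)
  rw [abs_le]
  constructor <;> omega

variable {Γ D : Matrix n n ℂ}

/-- **The index change across `[m₁, m₂]` is carried by small eigenvalues of `H(m₀)`.** For the Hermitian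
pencil `H(m) = ΓD + mΓ` (`Γ` Hermitian unitary, `ΓD` Hermitian) and `m₁ ≤ m₀ ≤ m₂`:
`|n₋(H(m₁)) − n₋(H(m₂))| ≤ #{eigenvalues e of H(m₀), |e| ≤ max (m₀ − m₁) (m₂ − m₀)}` (counts as
characteristic roots; `|Re v†(H(m) − H(m₀))v| ≤ |m − m₀| ‖v‖²`, landed `pencil_diff_bound`). [folklore] -/
theorem abs_negCount_sub_le_countP_abs_le (hΓ : Γᴴ = Γ) (hΓ2 : Γ * Γ = 1) (hD : (Γ * D)ᴴ = Γ * D)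
    {m₁ m₀ m₂ : ℝ} (hle₁ : m₁ ≤ m₀) (hle₂ : m₀ ≤ m₂) :
    |((Γ * D + (m₁ : ℂ) • Γ).charpoly.roots.countP (fun z => z.re < 0) : ℤ) -
        ((Γ * D + (m₂ : ℂ) • Γ).charpoly.roots.countP (fun z => z.re < 0) : ℤ)| ≤
      ((Γ * D + (m₀ : ℂ) • Γ).charpoly.roots.countP
        (fun z => |z.re| ≤ max (m₀ - m₁) (m₂ - m₀)) : ℤ) := by
  have hd₁ : |m₁ - m₀| = m₀ - m₁ := by rw [abs_sub_comm]; exact abs_of_nonneg (by linarith)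
  have hd₂ : |m₂ - m₀| = m₂ - m₀ := abs_of_nonneg (by linarith)
  have hE₁ := fun v => pencil_diff_bound (D := D) hΓ hΓ2 m₀ m₁ v
  have hE₂ := fun v => pencil_diff_bound (D := D) hΓ hΓ2 m₀ m₂ v
  simp only [hd₁] at hE₁
  simp only [hd₂] at hE₂
  have h := abs_card_neg_sub_card_neg_le (pencil_isHermitian hΓ hD m₀) (pencil_isHermitian hΓ hD m₁)
    (pencil_isHermitian hΓ hD m₂) (by linarith) (by linarith) hE₁ hE₂
  rw [countP_roots_eq_card_filter (pencil_isHermitian hΓ hD m₁) (· < 0),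
    countP_roots_eq_card_filter (pencil_isHermitian hΓ hD m₂) (· < 0),
    countP_roots_eq_card_filter (pencil_isHermitian hΓ hD m₀) (fun x => |x| ≤ max (m₀ - m₁) (m₂ - m₀))]
  exact h

end Abstract

/-! ## §2 Wilson fermions: TIGHT integrand ≤ clause (a) + small eigenvalues of `H_W` at the bare mass -/

section Wilson

variable {L : ℕ} [NeZero L]

/-- The colour group. -/
local notation "SU3" => Matrix.specialUnitaryGroup (Fin 3) ℂ

/-- **Index change of `H_W` across `[m₁, m₂]` ≤ eigenvalues of `H_W(m₀)` within the half-width of zero**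
(every `SU(3)` gauge field; `m₁ ≤ m₀ ≤ m₂`). [folklore] -/
theorem abs_negCount_hermitianWilson_sub_le_countP_abs_le (U : GaugeConfig 4 L SU3) {m₁ m₀ m₂ : ℝ}
    (h₁ : m₁ ≤ m₀) (h₂ : m₀ ≤ m₂) :
    |((spinorLift gammaFive * wilsonDirac (fundamentalRep (Fin 3)) U m₁ 1).charpoly.roots.countP
          (fun z : ℂ => z.re < 0) : ℤ) -
        ((spinorLift gammaFive * wilsonDirac (fundamentalRep (Fin 3)) U m₂ 1).charpoly.roots.countP
          (fun z : ℂ => z.re < 0) : ℤ)| ≤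
      ((spinorLift gammaFive * wilsonDirac (fundamentalRep (Fin 3)) U m₀ 1).charpoly.roots.countP
        (fun z : ℂ => |z.re| ≤ max (m₀ - m₁) (m₂ - m₀)) : ℤ) := by
  have hρ : ∀ g : SU3, fundamentalRep (Fin 3) g ∈ Matrix.unitaryGroup (Fin 3) ℂ :=
    fundamentalRep_mem_unitaryGroup
  rw [hermitianWilsonDirac_eq_pencil _ hρ U m₁, hermitianWilsonDirac_eq_pencil _ hρ U m₂,
    hermitianWilsonDirac_eq_pencil _ hρ U m₀]
  exact abs_negCount_sub_le_countP_abs_le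
    Literature.Barriers.QuantumFields.WilsonDeterminant.conjTranspose_spinorLift_gammaFive
    spinorLift_gammaFive_mul_self
    (Literature.Barriers.QuantumFields.WilsonDeterminant.isHermitian_hermitianWilsonDirac _ hρ U 0 1) h₁ h₂

/-- **TIGHT integrand ≤ sign defects + coercivity band AT THE BARE MASS.** For a line `m_crit`, a flavour
window `w_f > 0` (bare mass `m_crit + w_f`) and a probe depth `w_M ≥ 0`, on every `SU(3)` gauge field:
`|n₋(Γ₅D_W(U, m_crit − w_M, 1)) − 6L⁴| ≤ #{real λ ∈ spec D_W(U,0,1), λ < −(m_crit + w_f)}`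
`+ #{e ∈ spec Γ₅D_W(U, m_crit + w_f, 1), |e| ≤ w_f + w_M}` — triangle through the mass
`m₂ = m_crit + 2w_f + w_M` (index there ≤ real modes `≤ −m₂ < −(m_crit + w_f)`, landed
`abs_index_le_realModeCount`) and §1 on `[m_crit − w_M, m₂]` about `m₀ = m_crit + w_f`. [folklore] -/
theorem abs_index_le_signDefects_add_coercivityBand (U : GaugeConfig 4 L SU3) (mcrit wf wM : ℝ)
    (hwf : 0 < wf) (hwM : 0 ≤ wM) :
    |((spinorLift gammaFive * wilsonDirac (fundamentalRep (Fin 3)) U (mcrit - wM) 1).charpoly.roots.countP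
          (fun z : ℂ => z.re < 0) : ℤ) - 6 * (L : ℤ) ^ 4| ≤
      ((wilsonDirac (fundamentalRep (Fin 3)) U 0 1).charpoly.roots.countP
          (fun z : ℂ => z.im = 0 ∧ z.re < -(mcrit + wf)) : ℤ) +
        ((spinorLift gammaFive * wilsonDirac (fundamentalRep (Fin 3)) U (mcrit + wf) 1).charpoly.roots.countP
          (fun z : ℂ => |z.re| ≤ wf + wM) : ℤ) := by
  set m₂ := mcrit + 2 * wf + wM with hm₂
  have hband := abs_negCount_hermitianWilson_sub_le_countP_abs_le U
    (m₁ := mcrit - wM) (m₀ := mcrit + wf) (m₂ := m₂) (by linarith) (by linarith)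
  have hmax : max (mcrit + wf - (mcrit - wM)) (m₂ - (mcrit + wf)) = wf + wM := by
    rw [hm₂, max_eq_left (by linarith)]; ring
  rw [hmax] at hband
  have hidx := abs_index_le_realModeCount U m₂
  have hlt₂ : -m₂ < -(mcrit + wf) := by rw [hm₂]; linarith
  have hmono : ((wilsonDirac (fundamentalRep (Fin 3)) U 0 1).charpoly.roots.countP
      (fun z : ℂ => z.im = 0 ∧ z.re ≤ -m₂) : ℤ) ≤
      ((wilsonDirac (fundamentalRep (Fin 3)) U 0 1).charpoly.roots.countP
        (fun z : ℂ => z.im = 0 ∧ z.re < -(mcrit + wf)) : ℤ) := by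
    exact_mod_cast Summit.QuantumFields.QCD.Theorems.WindowExtinction.Negative.countP_mono_pred
      (wilsonDirac (fundamentalRep (Fin 3)) U 0 1).charpoly.roots
      (p := fun z : ℂ => z.im = 0 ∧ z.re ≤ -m₂) (q := fun z : ℂ => z.im = 0 ∧ z.re < -(mcrit + wf))
      fun z hz => ⟨hz.1, lt_of_le_of_lt hz.2 hlt₂⟩
  -- triangle inequality
  have htri : |((spinorLift gammaFive * wilsonDirac (fundamentalRep (Fin 3)) U (mcrit - wM) 1).charpoly.roots.countP
          (fun z : ℂ => z.re < 0) : ℤ) - 6 * (L : ℤ) ^ 4| ≤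
      |((spinorLift gammaFive * wilsonDirac (fundamentalRep (Fin 3)) U (mcrit - wM) 1).charpoly.roots.countP
            (fun z : ℂ => z.re < 0) : ℤ) -
          ((spinorLift gammaFive * wilsonDirac (fundamentalRep (Fin 3)) U m₂ 1).charpoly.roots.countP
            (fun z : ℂ => z.re < 0) : ℤ)| +
        |((spinorLift gammaFive * wilsonDirac (fundamentalRep (Fin 3)) U m₂ 1).charpoly.roots.countP
            (fun z : ℂ => z.re < 0) : ℤ) - 6 * (L : ℤ) ^ 4| := by
    have := abs_sub_le
      ((spinorLift gammaFive * wilsonDirac (fundamentalRep (Fin 3)) U (mcrit - wM) 1).charpoly.roots.countP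
          (fun z : ℂ => z.re < 0) : ℤ)
      ((spinorLift gammaFive * wilsonDirac (fundamentalRep (Fin 3)) U m₂ 1).charpoly.roots.countP
          (fun z : ℂ => z.re < 0) : ℤ)
      (6 * (L : ℤ) ^ 4)
    exact this
  linarith

/-- **… hence ≤ the clause-(a) + clause-(b) counts of ONE flavour whenever `c w_f > w_f + w_M`**
(`c > 1 + M/m_f` in the crux's parameters: `w_f = a_k m_f/Z_k`, `w_M = a_k M/Z_k`). [folklore] -/
theorem abs_index_le_signDefects_add_coercivityDefects (U : GaugeConfig 4 L SU3) (mcrit wf wM c : ℝ)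
    (hwf : 0 < wf) (hwM : 0 ≤ wM) (hc : wf + wM < c * wf) :
    |((spinorLift gammaFive * wilsonDirac (fundamentalRep (Fin 3)) U (mcrit - wM) 1).charpoly.roots.countP
          (fun z : ℂ => z.re < 0) : ℤ) - 6 * (L : ℤ) ^ 4| ≤
      ((wilsonDirac (fundamentalRep (Fin 3)) U 0 1).charpoly.roots.countP
          (fun z : ℂ => z.im = 0 ∧ z.re < -(mcrit + wf)) : ℤ) +
        ((spinorLift gammaFive * wilsonDirac (fundamentalRep (Fin 3)) U (mcrit + wf) 1).charpoly.roots.countP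
          (fun z : ℂ => |z.re| < c * wf) : ℤ) := by
  refine (abs_index_le_signDefects_add_coercivityBand U mcrit wf wM hwf hwM).trans (add_le_add le_rfl ?_)
  exact_mod_cast Summit.QuantumFields.QCD.Theorems.WindowExtinction.Negative.countP_mono_pred
    (spinorLift gammaFive * wilsonDirac (fundamentalRep (Fin 3)) U (mcrit + wf) 1).charpoly.roots
    (p := fun z : ℂ => |z.re| ≤ wf + wM) (q := fun z : ℂ => |z.re| < c * wf)
    fun z hz => lt_of_le_of_lt hz hc

end Wilson

end

end Summit.QuantumFields.QCD.Theorems.WindowExtinction.Negative
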